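import Literature.Computability.Cryptography.SIS
import Literature.Algebra.EuclideanLattices.GapCVPPrime
import HarnessLib

/-!
# Micciancio–Regev 2007, Theorem 5.23 proper (`GapCVP′ → SIS′`) and Lemma 5.22 at machine level

Topic `Computability/Cryptography` (family `pqc`), namespace `Literature.PQC`. Top brick of the
decomposition of the named fact `Literature.Computability.Cryptography.MicciancioRegev2007_gapSVP_to_SIS'` (`SIS.lean`), which
renders "Thm. 5.23 **with** Lemma 5.22" (GapSVP_γ → SIS′) in one statement. The printed chain is

  `GapSVP_γ →(Lemma 5.22: deterministic Cook reduction, n calls, same dimension, same γ)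
   GapCVP′_γ →(Thm. 5.23: PPT reduction using an average-case SIS′ oracle) SIS′_{q,m,β}`,

and this file separates the two links:

* NAMED FACT `MicciancioRegev2007_gapCVP'_to_SIS'` — Theorem 5.23 as printed (authors' full
  version p. 28), i.e. for `GapCVP′_γ` (`Literature.Lattice.GapCVP'.yes/no`, `GapCVPPrime.lean`), in the
  Lean rendering of `SIS.lean` ("reduction + PPT oracle successful on the dimensions `n ∈ S` ⇒ the
  promise problem restricted to dimensions in `S`, `n ≥ n₀`, is in textbook promise-BPP"). This is
  the deep part (Gaussian measures, smoothing parameter, discrete Gaussian sampling, the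
  Aharonov–Regev verifier); it stays a named fact.
* NAMED FACT `MicciancioRegev2007_lemma_5_22_promiseBPP'` — Lemma 5.22 in its standard meaning for
  probabilistic deciders ("By Lemma 5.22 this also implies a reduction from GapSVP_γ to SIS′",
  p. 27): promise-BPP membership transfers from `GapCVP′_γ` restricted to a set `T` of dimensions
  to `GapSVP_γ` restricted to `T`. It is PROVED (`MicciancioRegev2007_lemma_5_22_promiseBPP'_of_cook`)
  from two cleanly separated facts: the generic closure of promise-BPP under Cook reductions of
  promise problems (`PromiseProblem.mem_PromiseBPP'_of_cookReducible`, Goldreich 2006 §1.2, remark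
  after Def. 3; `PromiseCookReductions.lean`) and the polynomial running time of the step function
  of the explicit GMSS oracle algorithm (`gmssAlg_isPolyTime`, TM2 level;
  `GapCVPPrime.lean`, where Lemma 5.22 is PROVED as a Cook reduction of promise problems,
  `gapSVP_cookReducible_gapCVP'`, up to that running-time fact).
* PROVED assemblies: `MicciancioRegev2007_gapSVP_to_SIS'_of_gapCVP'` (Thm. 5.23 proper and the
  machine-level Lemma 5.22 give the combined fact) and `MicciancioRegev2007_gapSVP_to_SIS'_of_cook`
  (Thm. 5.23 proper, the generic Cook closure of promise-BPP and `gmssAlg_isPolyTime` give it).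
  So the unproved content of `MicciancioRegev2007_gapSVP_to_SIS'` is now: Thm. 5.23 proper, one
  generic complexity-theoretic closure fact, and one TM2 running-time fact.

## Faithfulness notes

* Thm. 5.23 verbatim (p. 28): "For any polynomially bounded functions `β(n), m(n), q(n) = n^{O(1)}`,
  with `q(n) ≥ 4 √(m(n)) n^{1.5} β(n)` and `γ(n) = 14π √n β(n)`, there is a probabilistic
  polynomial time reduction from solving GapCVP′_γ in the worst case to solving SIS′_{q,m,β} on
  the average with non-negligible probability." The proof's oracle `F` is queried on uniformly
  random `A ∈ ℤ_q^{n×m}` with `n` the dimension of the input lattice (p. 28: "the query `A` given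
  to the oracle by the combining procedure"), so success of the oracle on the dimensions `n ∈ S`
  yields a decider for instances of dimension `n ∈ S`; "for all sufficiently large `n`" (p. 29,
  `δ - mε/2 > δ/2`) is the `n₀`. The rendering (uniformity hypothesis `IsPolyTimeParams`, `RandAlg`
  oracle with `IsPPT`, success `≥ 1/n^c` on `S`, conclusion in `PromiseBPP'`) is the one fixed by
  `SIS.lean` for the combined statement, with `GapSVP` replaced by `GapCVP′` and the dimension of
  `((B, t), d)` read as `B.n`.
* Lemma 5.22 verbatim (p. 27): "For any approximation factor `γ(n)`, there is a polynomial time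
  reduction from GapSVP_γ to GapCVP′_γ." The GMSS calls preserve the dimension, so the reduction
  respects any restriction of the dimension set (`gapSVP_cookReducible_gapCVP'`).

## References

* D. Micciancio, O. Regev, *Worst-case to average-case reductions based on Gaussian measures*,
  SIAM J. Comput. 37(1) (2007) 267–302; authors' full version, Def. 5.21, Lemma 5.22 (p. 27),
  Thm. 5.23 (p. 28–30) [MicciancioRegev2007].
* O. Goldreich, D. Micciancio, S. Safra, J.-P. Seifert, *Approximating shortest lattice vectors
  is not harder than approximating closest lattice vectors*, IPL 71 (1999), Thm. 1
  [GoldreichMicciancioSafraSeifert1999].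
* O. Goldreich, *On promise problems: a survey*, LNCS 3895 (2006) 254–290, §1.2, Def. 3 and the
  remark following it (Cook reductions to promise problems in BPP) [Goldreich2006].
-/

noncomputable section

open Computability Literature.Computability.Complexity Literature.Algebra.EuclideanLattices Literature.Computability.Cryptography Literature.Computability.Cryptography.LWE Metric

namespace Literature.Computability.Cryptography

open SIS

/-! ### The two named facts -/

/-- NAMED FACT (**Micciancio–Regev 2007, Thm. 5.23** proper, GapCVP′ → SIS′; nothing is asserted,
users take `(h : MicciancioRegev2007_gapCVP'_to_SIS')`). Printed statement (authors' full
version, p. 28): for any polynomially bounded functions `β(n), m(n), q(n) = n^{O(1)}` with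
`q(n) ≥ 4 √(m(n)) n^{1.5} β(n)` and `γ(n) = 14 π √n β(n)`, there is a probabilistic
polynomial-time reduction from solving GapCVP′_γ in the worst case to solving SIS′_{q,m,β} on the
average with non-negligible probability. The reduction on an instance `((B, t), d)` with `B` of
dimension `n` queries the SIS′ oracle only on uniformly random `A ∈ ℤ_{q(n)}^{n×m(n)}` of the same
`n` (proof, p. 28), never errs on YES instances and errs with probability `2^{-Ω(n)}` on NO
instances for all sufficiently large `n` (p. 29). Lean rendering, as for the combined fact
`MicciancioRegev2007_gapSVP_to_SIS'` of `SIS.lean`: for parameters as above (`β > 0`, uniformity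
hypothesis `IsPolyTimeParams q β m`), for every PPT `B` (`RandAlg`, `IsPPT B id`), exponent `c`
and set `S` of dimensions, if `B` solves SIS′_{q(n),m(n),β(n)} on the average with probability
`≥ 1/n^c` for every `n ∈ S`, then for some `n₀` the promise problem GapCVP′_γ (MR07 Def. 5.21,
`GapCVP'.yes/no`) restricted to instances of dimension `n ∈ S`, `n ≥ n₀` (codes under
`gapCVPInstanceEncoding`) lies in textbook promise-BPP (`PromiseBPP'`). [cite: MicciancioRegev2007, Thm. 5.23 (authors' full version p. 28–30)] -/
def MicciancioRegev2007_gapCVP'_to_SIS' : Prop :=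
  ∀ (q m : ℕ → ℕ) [∀ n, NeZero (q n)] (β : ℕ → ℝ),
    IsPolyBounded q → IsPolyBounded m → IsPolyBoundedReal β → IsPolyTimeParams q β m →
    (∀ n, 0 < β n) → MRModulusCondition q m β →
    ∀ B : RandAlg (List Bool) (List Bool), IsPPT B id → ∀ (c : ℕ) (S : Set ℕ),
      (∀ n ∈ S, 1 / (n : ℝ) ^ c ≤ successProb' B n (m n) (q n) (β n)) →
      ∃ n₀ : ℕ, PromiseProblem.ofEncoding gapCVPInstanceEncoding
          {p | p ∈ GapCVP'.yes (mrGamma β) ∧ p.1.I.n ∈ S ∩ Set.Ici n₀}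
          {p | p ∈ GapCVP'.no (mrGamma β) ∧ p.1.I.n ∈ S ∩ Set.Ici n₀} ∈ PromiseBPP'

/-- NAMED FACT (**Micciancio–Regev 2007, Lemma 5.22**, in its standard meaning for probabilistic
polynomial-time deciders; nothing is asserted — but see
`MicciancioRegev2007_lemma_5_22_promiseBPP'_of_cook` below, which PROVES it from the generic
closure of promise-BPP under Cook reductions and the running time of the explicit reduction).
Printed statement (authors' full version p. 27): "For any approximation factor `γ(n)`, there is a
polynomial time reduction from GapSVP_γ to GapCVP′_γ" — the deterministic Cook reduction of
Goldreich–Micciancio–Safra–Seifert 1999: on input `(B, d)` call the oracle on `(B⁽ⁱ⁾, bᵢ, d)` for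
`i = 1, …, n` (same dimension `n`) and answer YES iff some call does; MR07 use it as "By
Lemma 5.22 this also implies a reduction from GapSVP_γ to SIS′" (p. 27), i.e. composed with a
probabilistic decider, per Goldreich 2006, §1.2 (Def. 3 and the remark after it, LNCS 3895
p. 258): if a promise problem Cook-reduces to a promise problem in BPP then it is in BPP. Lean
rendering (dimension-wise, matching the conclusion of the Thm. 5.23 facts): for every factor `γ`
and every set `T` of dimensions, if GapCVP′_γ restricted to instances of dimension in `T` is in
`PromiseBPP'` then so is GapSVP_γ restricted to instances of dimension in `T`. [cite: MicciancioRegev2007, Lemma 5.22 (authors' full version p. 27); Goldreich2006 §1.2 Def. 3 and remark p. 258] -/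
def MicciancioRegev2007_lemma_5_22_promiseBPP' : Prop :=
  ∀ (γ : ℕ → ℝ) (T : Set ℕ),
    PromiseProblem.ofEncoding gapCVPInstanceEncoding
        {p | p ∈ GapCVP'.yes γ ∧ p.1.I.n ∈ T} {p | p ∈ GapCVP'.no γ ∧ p.1.I.n ∈ T} ∈ PromiseBPP' →
    PromiseProblem.ofEncoding gapSVPInstanceEncoding
        {p | p ∈ GapSVP.yes γ ∧ p.1.n ∈ T} {p | p ∈ GapSVP.no γ ∧ p.1.n ∈ T} ∈ PromiseBPP'

/-- **Lemma 5.22 at machine level, proved up to two clean facts**: the generic closure of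
textbook promise-BPP under Cook reductions of promise problems (Goldreich 2006, remark after
Def. 3; `PromiseProblem.mem_PromiseBPP'_of_cookReducible`) and the polynomial running time of the
step function of the explicit GMSS oracle algorithm (`gmssAlg_isPolyTime`) give
`MicciancioRegev2007_lemma_5_22_promiseBPP'`, through the proved Cook reduction
`gapSVP_cookReducible_gapCVP'`. [cite: MicciancioRegev2007, Lemma 5.22 (authors' full version p. 27); Goldreich2006 §1.2 Def. 3 and remark p. 258] -/
theorem MicciancioRegev2007_lemma_5_22_promiseBPP'_of_cook
    (h₁ : PromiseProblem.mem_PromiseBPP'_of_cookReducible) (h₂ : gmssAlg_isPolyTime) :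
    MicciancioRegev2007_lemma_5_22_promiseBPP' :=
  fun γ T h => h₁ _ _ (gapSVP_cookReducible_gapCVP' h₂ γ T) h

/-! ### Assembly: Thm. 5.23 with Lemma 5.22 -/

/-- **MR07 Thm. 5.23 with Lemma 5.22** (`GapSVP_γ → SIS′`, the named fact
`MicciancioRegev2007_gapSVP_to_SIS'` of `SIS.lean`) follows from Thm. 5.23 proper and the
machine-level Lemma 5.22: apply the latter with `T = S ∩ [n₀, ∞)`. [cite: MicciancioRegev2007, Thm. 5.23 with Lemma 5.22 (authors' full version p. 27–28)] -/
theorem MicciancioRegev2007_gapSVP_to_SIS'_of_gapCVP' (h₁ : MicciancioRegev2007_gapCVP'_to_SIS')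
    (h₂ : MicciancioRegev2007_lemma_5_22_promiseBPP') : MicciancioRegev2007_gapSVP_to_SIS' := by
  intro q m _ β hq hm hβ hpar hβ0 hmod B hB c S hS
  obtain ⟨n₀, h⟩ := h₁ q m β hq hm hβ hpar hβ0 hmod B hB c S hS
  exact ⟨n₀, h₂ (mrGamma β) (S ∩ Set.Ici n₀) h⟩

/-- **MR07 Thm. 5.23 with Lemma 5.22** from Thm. 5.23 proper, the generic closure of promise-BPP
under Cook reductions of promise problems, and the running time of the GMSS step function.
[cite: MicciancioRegev2007, Thm. 5.23 with Lemma 5.22 (authors' full version p. 27–28)] -/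
theorem MicciancioRegev2007_gapSVP_to_SIS'_of_cook (h₁ : MicciancioRegev2007_gapCVP'_to_SIS')
    (h₂ : PromiseProblem.mem_PromiseBPP'_of_cookReducible) (h₃ : gmssAlg_isPolyTime) :
    MicciancioRegev2007_gapSVP_to_SIS' :=
  MicciancioRegev2007_gapSVP_to_SIS'_of_gapCVP' h₁
    (MicciancioRegev2007_lemma_5_22_promiseBPP'_of_cook h₂ h₃)

end Literature.Computability.Cryptography

end
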